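import Mathlib
import Summits.CriticalPhenomena.Ising3DConformalLimit.Theses.PrimaryAtInfinity

/-!
# Route PrimaryAtInfinity · support item `MultipoleToWard` — analytic helpers

Generic lemmas of real analysis on `ℝ³ = EuclideanSpace ℝ (Fin 3)` and on the configuration
spaces `Fin n → ℝ³`, used by the proof of
`Summit.CriticalPhenomena.Ising3DConformalLimit.Theses.PrimaryAtInfinity.MultipoleToWard`
(file `PrimaryAtInfinityMultipoleToWard.lean`):

* `exists_even_annular_bump` — an even `C^∞` bump vanishing on the closed unit ball with
  `0 < ∫ χ` (the radial cut-off `χ_L(z) = χ(z/L)` of the proof is built from it);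
* `integral_eq_zero_of_odd` — odd functions on `ℝ³` integrate to `0`;
* `exists_radius_of_tendstoLocallyUniformlyOn` — locally uniform convergence to `0` along
  `cocompact ℝ³` yields, on a compact set, a uniform `ε`-bound outside a ball;
* `integrable_mul_of_continuousOn_tsupport` — `f * g` is integrable when `g` is continuous with
  compact support and `f` is continuous on `tsupport g`;
* `integral_comp_snoc`, `integral_fst_mul_snd` — Fubini bookkeeping through the last point;
* `snoc_mem_nonCoincident`, `hasCompactSupport_init_mul_last`, `contDiff_init_mul_last`,
  `fderiv_init_mul_last_apply`, `kOne_comp_inv_smul`, `integral_comp_inv_smul_three` —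
  bookkeeping for tensor test functions `ψ(x, z) = φ(x) χ(z/L)`.

THEOREM-ONLY file (no definitions, no named facts). Sources: standard real analysis
(Hörmander, *ALPDO I*, §1); the use made of them follows Di Francesco–Mathieu–Sénéchal 1997
§4.2–4.3 (special conformal Ward identity). [folklore]
-/

noncomputable section

namespace Summit.CriticalPhenomena.Ising3DConformalLimit.Theorems.PrimaryAtInfinityMultipoleToWard

open MeasureTheory Filter Set Function Metric
open scoped Topology

/-! ### An even annular bump -/

/-- There is an even smooth function `χ : ℝ³ → ℝ` with compact support, vanishing on the closed
unit ball, with `0 < ∫ χ` (namely `f₁ · (1 - f₂)` for two centred smooth bumps). [folklore] -/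
theorem exists_even_annular_bump :
    ∃ χ : EuclideanSpace ℝ (Fin 3) → ℝ, ContDiff ℝ ((⊤ : ℕ∞) : WithTop ℕ∞) χ ∧
      HasCompactSupport χ ∧ (∀ x, χ (-x) = χ x) ∧ (∀ x, ‖x‖ ≤ 1 → χ x = 0) ∧ 0 < ∫ x, χ x := by
  let f₁ : ContDiffBump (0 : EuclideanSpace ℝ (Fin 3)) := ⟨3, 4, by norm_num, by norm_num⟩
  let f₂ : ContDiffBump (0 : EuclideanSpace ℝ (Fin 3)) := ⟨1, 2, by norm_num, by norm_num⟩
  refine ⟨fun x => f₁ x * (1 - f₂ x), ?_, ?_, ?_, ?_, ?_⟩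
  · exact f₁.contDiff.mul (contDiff_const.sub f₂.contDiff)
  · exact f₁.hasCompactSupport.mul_right
  · intro x
    simp only [f₁.neg, f₂.neg]
  · intro x hx
    have h2 : f₂ x = 1 := f₂.one_of_mem_closedBall (by simpa using hx)
    simp [h2]
  · obtain ⟨x₀, hx₀⟩ : ∃ x : EuclideanSpace ℝ (Fin 3), ‖x‖ = 3 :=
      exists_norm_eq (EuclideanSpace ℝ (Fin 3)) (by norm_num)
    refine Continuous.integral_pos_of_hasCompactSupport_nonneg_nonzero (x := x₀)
      (f₁.continuous.mul (continuous_const.sub f₂.continuous)) f₁.hasCompactSupport.mul_right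
      (fun x => mul_nonneg f₁.nonneg (sub_nonneg.2 f₂.le_one)) ?_
    have h1 : f₁ x₀ = 1 := f₁.one_of_mem_closedBall (by
      rw [mem_closedBall, dist_zero_right, hx₀])
    have h2 : f₂ x₀ = 0 := f₂.zero_of_le_dist (by
      rw [dist_zero_right, hx₀]; show (2 : ℝ) ≤ 3; norm_num)
    simp [h1, h2]

/-! ### Odd integrands -/

/-- An odd real function on `ℝ³` has integral zero (Lebesgue measure is invariant under
`x ↦ -x`; no integrability is needed thanks to the junk-value convention). [folklore] -/
theorem integral_eq_zero_of_odd {f : EuclideanSpace ℝ (Fin 3) → ℝ} (hf : ∀ x, f (-x) = -f x) :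
    ∫ x, f x = 0 := by
  have h : ∫ x, f (-x) = ∫ x, f x := integral_neg_eq_self f volume
  simp only [hf, integral_neg] at h
  linarith

/-! ### Uniform bounds from locally uniform convergence along `cocompact ℝ³` -/

/-- If `G z → 0` locally uniformly on `s` as `z → ∞` in `ℝ³`, then on every compact `K ⊆ s` and
for every `ε > 0` there is a radius beyond which `‖G z x‖ ≤ ε` for all `x ∈ K`. [folklore] -/
theorem exists_radius_of_tendstoLocallyUniformlyOn {X F : Type*} [TopologicalSpace X]
    [NormedAddCommGroup F] {G : EuclideanSpace ℝ (Fin 3) → X → F} {s K : Set X}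
    (h : TendstoLocallyUniformlyOn G 0 (cocompact (EuclideanSpace ℝ (Fin 3))) s)
    (hK : IsCompact K) (hKs : K ⊆ s) {ε : ℝ} (hε : 0 < ε) :
    ∃ R : ℝ, ∀ z : EuclideanSpace ℝ (Fin 3), R ≤ ‖z‖ → ∀ x ∈ K, ‖G z x‖ ≤ ε := by
  have h1 : TendstoUniformlyOn G 0 (cocompact (EuclideanSpace ℝ (Fin 3))) K :=
    (tendstoLocallyUniformlyOn_iff_tendstoUniformlyOn_of_compact hK).1 (h.mono hKs)
  have h2 := Metric.tendstoUniformlyOn_iff.1 h1 ε hε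
  obtain ⟨t, ht, hts⟩ := mem_cocompact.1 h2
  obtain ⟨R, hR⟩ := ht.isBounded.subset_closedBall 0
  refine ⟨R + 1, fun z hz x hx => ?_⟩
  have hzt : z ∉ t := fun hzt => by
    have := hR hzt
    rw [mem_closedBall, dist_zero_right] at this
    linarith
  have := hts hzt x hx
  rw [Pi.zero_apply, dist_comm, dist_zero_right] at this
  exact this.le

/-! ### Integrability against compactly supported continuous weights -/

/-- `f * g` is integrable if `g` is continuous with compact support and `f` is continuous on
`tsupport g`. [folklore] -/
theorem integrable_mul_of_continuousOn_tsupport {X : Type*} [TopologicalSpace X]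
    [MeasurableSpace X] [OpensMeasurableSpace X] [T2Space X] {μ : Measure X}
    [IsFiniteMeasureOnCompacts μ] {f g : X → ℝ} (hg : Continuous g)
    (hgc : HasCompactSupport g) (hf : ContinuousOn f (tsupport g)) :
    Integrable (fun x => f x * g x) μ := by
  have hsub : support (fun x => f x * g x) ⊆ tsupport g := by
    intro x hx
    rw [mem_support, mul_ne_zero_iff] at hx
    exact subset_tsupport _ hx.2
  rw [← integrableOn_iff_integrable_of_support_subset hsub]
  exact (hf.mul hg.continuousOn).integrableOn_compact hgc

/-! ### Fubini bookkeeping through the last point -/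

/-- Transfer through the last coordinate: `∫ w, G w = ∫ (z, x), G (Fin.snoc x z)` for every `G`
(no integrability needed: the map is a measure-preserving equivalence). [folklore] -/
theorem integral_comp_snoc {n : ℕ} (G : (Fin (n + 1) → EuclideanSpace ℝ (Fin 3)) → ℝ) :
    ∫ w, G w = ∫ p : EuclideanSpace ℝ (Fin 3) × (Fin n → EuclideanSpace ℝ (Fin 3)),
      G (Fin.snoc p.2 p.1) := by
  set e := MeasurableEquiv.piFinSuccAbove (fun _ : Fin (n + 1) => EuclideanSpace ℝ (Fin 3))
    (Fin.last n) with he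
  have hmp : MeasurePreserving e.symm
      (volume : Measure (EuclideanSpace ℝ (Fin 3) × (Fin n → EuclideanSpace ℝ (Fin 3)))) volume :=
    (volume_preserving_piFinSuccAbove (fun _ : Fin (n + 1) => EuclideanSpace ℝ (Fin 3))
      (Fin.last n)).symm
  have hsymm : ∀ p : EuclideanSpace ℝ (Fin 3) × (Fin n → EuclideanSpace ℝ (Fin 3)),
      e.symm p = Fin.snoc p.2 p.1 := fun p =>
    Fin.insertNth_last' p.1 p.2
  rw [← hmp.integral_comp']
  simp only [hsymm]

/-- `∫ (z, x), f z * g x = (∫ f) * (∫ g)` on `ℝ³ × (Fin n → ℝ³)`. [folklore] -/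
theorem integral_fst_mul_snd {n : ℕ} (f : EuclideanSpace ℝ (Fin 3) → ℝ)
    (g : (Fin n → EuclideanSpace ℝ (Fin 3)) → ℝ) :
    ∫ p : EuclideanSpace ℝ (Fin 3) × (Fin n → EuclideanSpace ℝ (Fin 3)), f p.1 * g p.2
      = (∫ z, f z) * ∫ x, g x := by
  rw [Measure.volume_eq_prod]
  exact integral_prod_mul f g

/-- Integrability of `(z, x) ↦ f z * g x` from integrability of the factors. [folklore] -/
theorem integrable_fst_mul_snd {n : ℕ} {f : EuclideanSpace ℝ (Fin 3) → ℝ}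
    {g : (Fin n → EuclideanSpace ℝ (Fin 3)) → ℝ} (hf : Integrable f) (hg : Integrable g) :
    Integrable (fun p : EuclideanSpace ℝ (Fin 3) × (Fin n → EuclideanSpace ℝ (Fin 3)) =>
      f p.1 * g p.2) := by
  rw [Measure.volume_eq_prod]
  exact hf.mul_prod hg

/-! ### Configurations with a far last point -/

/-- Appending a point `z` farther from the origin than every `x i` to a non-coincident
configuration `x` gives a non-coincident configuration. [folklore] -/
theorem snoc_mem_nonCoincident {n : ℕ} {x : Fin n → EuclideanSpace ℝ (Fin 3)}
    {z : EuclideanSpace ℝ (Fin 3)}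
    (hx : x ∈ Literature.Probability.LatticeModels.NonCoincident 3 n) (hz : ∀ i, ‖x i‖ < ‖z‖) :
    (Fin.snoc x z : Fin (n + 1) → EuclideanSpace ℝ (Fin 3)) ∈
      Literature.Probability.LatticeModels.NonCoincident 3 (n + 1) := by
  rw [Literature.Probability.LatticeModels.mem_nonCoincident] at hx ⊢
  refine Fin.snoc_injective_iff.2 ⟨hx, ?_⟩
  rintro ⟨i, hi⟩
  exact (hz i).ne (by rw [hi])

/-- Continuity of `(z, x) ↦ Fin.snoc x z`. [folklore] -/
theorem continuous_snoc_prod {n : ℕ} :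
    Continuous fun p : EuclideanSpace ℝ (Fin 3) × (Fin n → EuclideanSpace ℝ (Fin 3)) =>
      (Fin.snoc p.2 p.1 : Fin (n + 1) → EuclideanSpace ℝ (Fin 3)) := by
  refine continuous_pi fun i => ?_
  induction i using Fin.lastCases with
  | last => simp only [Fin.snoc_last]; exact continuous_fst
  | cast j => simp only [Fin.snoc_castSucc]; exact (continuous_apply j).comp continuous_snd

/-- Continuity of `w ↦ Fin.snoc w y` for a fixed last point `y`. [folklore] -/
theorem continuous_snoc_left {m : ℕ} (y : EuclideanSpace ℝ (Fin 3)) :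
    Continuous fun w : Fin m → EuclideanSpace ℝ (Fin 3) =>
      (Fin.snoc w y : Fin (m + 1) → EuclideanSpace ℝ (Fin 3)) :=
  continuous_snoc_prod.comp (continuous_const.prodMk continuous_id)

/-! ### Tensor test functions `ψ w = φ (Fin.init w) * χ (w (Fin.last n))` -/

/-- Compact support of a tensor test function, and where its topological support lies.
[folklore] -/
theorem hasCompactSupport_init_mul_last {n : ℕ} {φ : (Fin n → EuclideanSpace ℝ (Fin 3)) → ℝ}
    {χ : EuclideanSpace ℝ (Fin 3) → ℝ} (hφ : HasCompactSupport φ) (hχ : HasCompactSupport χ) :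
    HasCompactSupport (fun w : Fin (n + 1) → EuclideanSpace ℝ (Fin 3) =>
        φ (Fin.init w) * χ (w (Fin.last n))) ∧
      tsupport (fun w : Fin (n + 1) → EuclideanSpace ℝ (Fin 3) =>
          φ (Fin.init w) * χ (w (Fin.last n)))
        ⊆ (fun p : EuclideanSpace ℝ (Fin 3) × (Fin n → EuclideanSpace ℝ (Fin 3)) =>
            (Fin.snoc p.2 p.1 : Fin (n + 1) → EuclideanSpace ℝ (Fin 3))) ''
          (tsupport χ ×ˢ tsupport φ) := by
  set K' := (fun p : EuclideanSpace ℝ (Fin 3) × (Fin n → EuclideanSpace ℝ (Fin 3)) =>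
    (Fin.snoc p.2 p.1 : Fin (n + 1) → EuclideanSpace ℝ (Fin 3))) '' (tsupport χ ×ˢ tsupport φ)
    with hK'
  have hK'c : IsCompact K' := (hχ.isCompact.prod hφ.isCompact).image continuous_snoc_prod
  have hsub : support (fun w : Fin (n + 1) → EuclideanSpace ℝ (Fin 3) =>
      φ (Fin.init w) * χ (w (Fin.last n))) ⊆ K' := by
    intro w hw
    rw [mem_support, mul_ne_zero_iff] at hw
    exact ⟨(w (Fin.last n), Fin.init w), ⟨subset_tsupport _ hw.2, subset_tsupport _ hw.1⟩,
      Fin.snoc_init_self w⟩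
  exact ⟨HasCompactSupport.of_support_subset_isCompact hK'c hsub,
    closure_minimal hsub hK'c.isClosed⟩

/-- Smoothness of a tensor test function. [folklore] -/
theorem contDiff_init_mul_last {n : ℕ} {φ : (Fin n → EuclideanSpace ℝ (Fin 3)) → ℝ}
    {χ : EuclideanSpace ℝ (Fin 3) → ℝ} {m : WithTop ℕ∞}
    (hφ : ContDiff ℝ m φ) (hχ : ContDiff ℝ m χ) :
    ContDiff ℝ m (fun w : Fin (n + 1) → EuclideanSpace ℝ (Fin 3) =>
      φ (Fin.init w) * χ (w (Fin.last n))) := by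
  refine (hφ.comp ?_).mul (hχ.comp (contDiff_apply ℝ (EuclideanSpace ℝ (Fin 3)) (Fin.last n)))
  exact contDiff_pi.2 fun i => contDiff_apply ℝ (EuclideanSpace ℝ (Fin 3)) (Fin.castSucc i)

/-- The derivative of a tensor test function at `Fin.snoc x z`, applied to a vector `V`.
[folklore] -/
theorem fderiv_init_mul_last_apply {n : ℕ} {φ : (Fin n → EuclideanSpace ℝ (Fin 3)) → ℝ}
    {χ : EuclideanSpace ℝ (Fin 3) → ℝ} (hφ : Differentiable ℝ φ) (hχ : Differentiable ℝ χ)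
    (x : Fin n → EuclideanSpace ℝ (Fin 3)) (z : EuclideanSpace ℝ (Fin 3))
    (V : Fin (n + 1) → EuclideanSpace ℝ (Fin 3)) :
    fderiv ℝ (fun w : Fin (n + 1) → EuclideanSpace ℝ (Fin 3) =>
        φ (Fin.init w) * χ (w (Fin.last n))) (Fin.snoc x z) V
      = χ z * fderiv ℝ φ x (Fin.init V) + φ x * fderiv ℝ χ z (V (Fin.last n)) := by
  let initL : (Fin (n + 1) → EuclideanSpace ℝ (Fin 3)) →L[ℝ] (Fin n → EuclideanSpace ℝ (Fin 3)) :=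
    ContinuousLinearMap.pi fun i => ContinuousLinearMap.proj (Fin.castSucc i)
  let lastL : (Fin (n + 1) → EuclideanSpace ℝ (Fin 3)) →L[ℝ] EuclideanSpace ℝ (Fin 3) :=
    ContinuousLinearMap.proj (Fin.last n)
  have hinit : ∀ w, initL w = Fin.init w := fun w => rfl
  have hlast : ∀ w, lastL w = w (Fin.last n) := fun w => rfl
  have h1 : HasFDerivAt (fun w : Fin (n + 1) → EuclideanSpace ℝ (Fin 3) => φ (Fin.init w))
      ((fderiv ℝ φ x).comp initL) (Fin.snoc x z) := by
    have := (hφ (initL (Fin.snoc x z))).hasFDerivAt.comp (Fin.snoc x z) initL.hasFDerivAt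
    simpa only [hinit, Fin.init_snoc, Function.comp_def] using this
  have h2 : HasFDerivAt (fun w : Fin (n + 1) → EuclideanSpace ℝ (Fin 3) => χ (w (Fin.last n)))
      ((fderiv ℝ χ z).comp lastL) (Fin.snoc x z) := by
    have := (hχ (lastL (Fin.snoc x z))).hasFDerivAt.comp (Fin.snoc x z) lastL.hasFDerivAt
    simpa only [hlast, Fin.snoc_last, Function.comp_def] using this
  rw [(h1.fun_mul h2).fderiv]
  simp only [add_apply, FunLike.coe_smul, Pi.smul_apply,
    ContinuousLinearMap.comp_apply, hinit, hlast, Fin.init_snoc, Fin.snoc_last, smul_eq_mul]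
  ring

/-! ### Dilations -/

/-- The one-point adjoint special-conformal expression of a dilated cut-off `z ↦ χ (L⁻¹ • z)` is
`L` times that of `χ` at `L⁻¹ • z` (the vector field `‖z‖² b - 2 ⟪b, z⟫ z` is homogeneous of
degree two). [folklore] -/
theorem kOne_comp_inv_smul (Δ : ℝ) (b : EuclideanSpace ℝ (Fin 3))
    (χ : EuclideanSpace ℝ (Fin 3) → ℝ) {L : ℝ} (hL : 0 < L) (z : EuclideanSpace ℝ (Fin 3)) :
    (2 * Δ - 6) * inner ℝ b z * χ (L⁻¹ • z)
        + fderiv ℝ (fun w => χ (L⁻¹ • w)) z (‖z‖ ^ 2 • b - (2 * inner ℝ b z) • z)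
      = L * ((2 * Δ - 6) * inner ℝ b (L⁻¹ • z) * χ (L⁻¹ • z)
        + fderiv ℝ χ (L⁻¹ • z)
            (‖L⁻¹ • z‖ ^ 2 • b - (2 * inner ℝ b (L⁻¹ • z)) • (L⁻¹ • z))) := by
  rw [fderiv_comp_smul]
  have hv : ‖L⁻¹ • z‖ ^ 2 • b - (2 * inner ℝ b (L⁻¹ • z)) • (L⁻¹ • z)
      = (L⁻¹) ^ 2 • (‖z‖ ^ 2 • b - (2 * inner ℝ b z) • z) := by
    rw [norm_smul, inner_smul_right, Real.norm_eq_abs, abs_inv, abs_of_pos hL, smul_sub,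
      smul_smul, smul_smul, smul_smul]
    congr 1 <;> ring_nf
  rw [hv, map_smul, FunLike.coe_smul, Pi.smul_apply, inner_smul_right, smul_eq_mul,
    smul_eq_mul]
  field_simp

/-- Change of variables `z ↦ L⁻¹ • z` in `ℝ³`. [folklore] -/
theorem integral_comp_inv_smul_three (f : EuclideanSpace ℝ (Fin 3) → ℝ) {L : ℝ} (hL : 0 ≤ L) :
    ∫ z, f (L⁻¹ • z) = L ^ 3 * ∫ z, f z := by
  rw [Measure.integral_comp_inv_smul_of_nonneg volume f hL, finrank_euclideanSpace_fin,
    smul_eq_mul]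

end Summit.CriticalPhenomena.Ising3DConformalLimit.Theorems.PrimaryAtInfinityMultipoleToWard

end
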